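import Mathlib
import Literature.NumberTheory.EllipticCurves.BSDSelmerPConverseYanZhuKolyvaginSystemProofs
import Literature.NumberTheory.EllipticCurves.HeegnerPointsOfConductorOneGaloisConjProofs
import Literature.NumberTheory.EllipticCurves.BSDHeegnerPointsGrossZagierProofs
import Literature.NumberTheory.EllipticCurves.LeadingTermProofs
import HarnessLib

/-!
# Route `GenusKolyvaginAtTwo`, crux `GenusPrimitiveSupplyAtTwo` (stmt-BirchSwinnertonDyer-22136), line `genus-supply`:
# stub B `stub_heegnerNonTorsionAtTwo` CLOSED MODULO THE PUBLISHED FACTS `hasEntireLFunction_rat` + `gross_zagier`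

Stub B of the registered skeleton `Cruxes/GenusPrimitiveSupplyAtTwo/Lines/genus_supply.lean` (lead seat bsd-line-gk2-p1):
for `E/ℚ` (globally minimal `W`), `K` imaginary quadratic with the Heegner hypothesis for `N_E`, `r_an(E) = 0` and
`r_an(E^{(d_K)}) = 1`, every conductor-`1` Kolyvagin–Heegner datum has `P(1) = y_K` of infinite order. This is
Gross–Zagier 1986 Thm. I.6.3 (with V.§2) read through `L(E/K, s) = L(E, s) · L(E^{(d_K)}, s)` (I.§7) and Gross 1991 §4
(`P_1 = Tr_{K_1/K} y_1 = y_K`). Assembled here from the tree, with the two standing named facts of the BSD literature as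
hypotheses — modularity `hasEntireLFunction_rat` (orders of vanishing add: `analyticRankEK_eq_add_of`) and the
Gross–Zagier formula `gross_zagier N_E W K` (`lDerivEK_ne_zero_iff_not_isOfFinAddOrder`) —, the descent of `P(1)` to a
Heegner point of `E(K)` being PROVED in the tree (`heegnerSystem_exists_isHeegnerPoint_map_eq_derivedPoint_one` with
Shimura reciprocity at conductor `1`, `heegnerPointOfConductor_one_galoisConj_holds`). A helper for the crux item
(`--supports stmt-BirchSwinnertonDyer-22136`, helper mode): the registered stub's statement is the conclusion of
`stub_heegnerNonTorsionAtTwo_of_published` after its two fact binders. No summit and no leaf is proved by this file;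
BSD is not proved by any of this.
-/

set_option linter.dupNamespace false -- tree convention: `Summit.BirchSwinnertonDyer.BirchSwinnertonDyer.Theorems` (summit = sub-problem)

noncomputable section

open scoped Classical

namespace Summit.BirchSwinnertonDyer.BirchSwinnertonDyer.Theorems.GenusKoly

open WeierstrassCurve Literature.NumberTheory.EllipticCurves Literature.NumberTheory.EllipticCurves.ModularForms

/-- **`y_K` has infinite order when `r_an(E) = 0` and `r_an(E^{(d_K)}) = 1`** (Gross–Zagier 1986 Thm. I.6.3 with V.§2 and
I.§7; Gross 1991 (1.1) «`y_K` has infinite order iff `L'(E/K,1) ≠ 0`» and §4 «`P_1 = y_K`»), modulo modularity (`hE`) and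
the Gross–Zagier formula (`hGZ`): `ord_{s=1} L(E/K,s) = r_an(E) + r_an(E^{(d_K)}) = 1`, so `L'(E/K,1) ≠ 0`, so the Heegner
point `P₀ ∈ E(K)` under `P(1)` has infinite order, and `E(K) → E(K[1])` is injective.
[cite: GrossZagier1986, Thm. I.6.3 with V.§2 and I.§7] [cite: GrossLMS1991, §1 (1.1) and §4 (P_1 = y_K)] -/
theorem not_isOfFinAddOrder_derivedPoint_one_of_published (hE : hasEntireLFunction_rat)
    (W : WeierstrassCurve ℚ) [W.IsElliptic] [NeZero (W.conductorNorm ℤ)]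
    (K : Type) [Field K] [NumberField K] (hGZ : gross_zagier (W.conductorNorm ℤ) W K)
    (hK : IsImaginaryQuadratic K) (hH : SatisfiesHeegnerHypothesis (W.conductorNorm ℤ) K)
    (hr0 : W.analyticRank = 0) (hr1 : (W.quadraticTwist (NumberField.discr K : ℚ)).analyticRank = 1)
    {Dt : ModularParametrizationData W (W.conductorNorm ℤ)} {β : ℤ} {ι : K →+* ℂ}
    (d₁ : KolyvaginHeegnerData Dt β ι 1) : ¬ IsOfFinAddOrder d₁.derivedPoint := by
  have hEK : analyticRankEK W K = 1 := by rw [analyticRankEK_eq_add_of hE W K, hr0, hr1]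
  have hL : LDerivEK W K ≠ 0 := LDerivEK_ne_zero_of_analyticRankEK_eq_one W K hEK
  obtain ⟨P₀, hP₀, hmap⟩ := heegnerSystem_exists_isHeegnerPoint_map_eq_derivedPoint_one
    (heegnerPointOfConductor_one_galoisConj_holds (W.conductorNorm ℤ) W K) hK hH d₁
  have hP₀inf : ¬ IsOfFinAddOrder P₀ :=
    (lDerivEK_ne_zero_iff_not_isOfFinAddOrder W (W.conductorNorm ℤ) K hGZ hK hH hP₀).mp hL
  intro hfin
  apply hP₀inf
  rw [← hmap] at hfin
  exact (WeierstrassCurve.Affine.Point.map_injective (W' := W) _).isOfFinAddOrder_iff.mp hfin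

/-- **Stub B of line `genus-supply`, closed modulo the published facts**: after the two fact binders (`hasEntireLFunction_rat`,
`gross_zagier` at every `(N_E, W, K)`) the statement is the REGISTERED signature of `stub_heegnerNonTorsionAtTwo`, verbatim
(the `[W.IsGloballyMinimal]` binder of the stub is idle here and kept for the match).
[cite: GrossZagier1986, Thm. I.6.3 with V.§2 and I.§7] [cite: GrossLMS1991, §4 (P_1 = y_K)] -/
theorem stub_heegnerNonTorsionAtTwo_of_published (hE : hasEntireLFunction_rat)
    (hGZ : ∀ (W : WeierstrassCurve ℚ) [NeZero (W.conductorNorm ℤ)] (K : Type) [Field K] [NumberField K],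
      gross_zagier (W.conductorNorm ℤ) W K) :
    ∀ (W : WeierstrassCurve ℚ) [W.IsElliptic] [W.IsGloballyMinimal] [NeZero (W.conductorNorm ℤ)]
      (K : Type) [Field K] [NumberField K],
      IsImaginaryQuadratic K → SatisfiesHeegnerHypothesis (W.conductorNorm ℤ) K →
      W.analyticRank = 0 → (W.quadraticTwist (NumberField.discr K : ℚ)).analyticRank = 1 →
      ∀ (Dt : ModularParametrizationData W (W.conductorNorm ℤ)) (β : ℤ) (ι : K →+* ℂ)
        (d₁ : KolyvaginHeegnerData Dt β ι 1), ¬ IsOfFinAddOrder d₁.derivedPoint :=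
  fun W _ _ _ K _ _ hK hH hr0 hr1 _Dt _β _ι d₁ ↦
    not_isOfFinAddOrder_derivedPoint_one_of_published hE W K (hGZ W K) hK hH hr0 hr1 d₁

end Summit.BirchSwinnertonDyer.BirchSwinnertonDyer.Theorems.GenusKoly

end
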